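import Literature.Computability.MetaComplexity.DPReconstructionHybrid
import Literature.Computability.MetaComplexity.DPReconstruction
import HarnessLib

/-!
# Complexity meta: the advice reconstruction for `DP_k` is polynomial time (the `FP` program of Lemma 3.14)

Topic `Literature/Computability/MetaComplexity`, machine layer of `DPReconstructionHybrid.lean`
(Hirahara, ECCC TR21-058, Lemma 3.14: "`R^D : {0,1}^k × {0,1}^r → {0,1}ⁿ` is called a reconstruction
procedure and is computable in time `poly(n/δ)`"). For a polynomial-time test with auxiliary input and
fixed coins, `ω ↦ [⟨a, ω ‖ ρ⟩ ∈ D₀]` (`D₀ ∈ P`), the run `DPHybStr.hrun` is ONE polynomial-time string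
function of `⟨params, w⟩`, `params = ⟨a, 1ⁿ, 1ᵏ, 1^M, 1ʲ, [sgn], α, ρ⟩` (`M ≥ 1` codes the number of
seeds `kk = ⌊log₂ M⌋ + 1`, so that `2^kk − 1 ≥ M`), `w` the coins:

* `DPHybProg.hrecF D₀` — the program: the context record of `Cryptography/GoldreichLevinProgram.lean`
  (with mask `e_j`-style data: prefix / zero masks / suffix of the blocks, parity bit `u_j`, bits
  `α ‖ u⇂j ‖ ρ`) and its two clocked loops around one call of the test; `hrecF_apply`
  (`= DPHybStr.hrun …` on genuine parameters), `hrecF_mem_FP`;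
* `DPHybProg.hparams`, `DPHybProg.kkOf M = ⌊log₂ M⌋ + 1`, `predRec_hyb` (the record-level predictor is
  `DPHybStr.hybPred`).

## References

* S. Hirahara, ECCC TR21-058 (2021), Lemma 3.14 (pp. 23–24), Lemma 3.11, Thm. 3.12.
* O. Goldreich, *Foundations of Cryptography I*, CUP 2001, Thm. 2.5.6 (proof: the inverter is polynomial time).
* S. Arora, B. Barak, *Computational Complexity: A Modern Approach*, CUP 2009, Thm. 9.12, §1.3–1.4.
-/

noncomputable section

namespace Literature.Computability.MetaComplexity

open _root_.Computability Polynomial Complexity Complexity.Brick Complexity.Plumb Complexity.OracleCompose Complexity.HashBricks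
open Literature.Computability.Cryptography Cryptography.CondRed Cryptography.GLDec Cryptography.GLBricks Cryptography.GLInv Cryptography.GLProg

namespace DPHybProg

/-! ### Parameters -/

/-- `kk = ⌊log₂ M⌋ + 1` seeds for `M` wanted pairwise independent samples (`2^kk − 1 ≥ M`). [folklore] -/
def kkOf (M : ℕ) : ℕ := Nat.log 2 M + 1

/-- `M < 2^kk`. [folklore] -/
theorem lt_two_pow_kkOf (M : ℕ) : M < 2 ^ kkOf M := Nat.lt_pow_succ_log_self one_lt_two _

/-- `2^kk ≤ 2M` for `M ≥ 1`. [folklore] -/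
theorem two_pow_kkOf_le {M : ℕ} (hM : 1 ≤ M) : 2 ^ kkOf M ≤ 2 * M := by
  rw [kkOf, pow_succ, mul_comm]
  exact Nat.mul_le_mul_left 2 (Nat.pow_log_le_self 2 (by omega))

/-- **The parameter record** `⟨a, 1ⁿ, 1ᵏ, 1^M, 1ʲ, [sgn], α, ρ⟩`. [folklore] -/
def hparams (a : List Bool) (n k M j : ℕ) (sgn : Bool) (α ρ : List Bool) : List Bool :=
  boolPair a (boolPair (ones n) (boolPair (ones k) (boolPair (ones M) (boolPair (ones j) (boolPair [sgn] (boolPair α ρ))))))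

/-! ### The program (on `z = ⟨params, w⟩`) -/

section Program

variable (D₀ : Set (List Bool))

/-- `a`. [folklore] -/
def aF : List Bool → List Bool := fstF ∘ fstF
/-- `1ⁿ`. [folklore] -/
noncomputable def uN : List Bool → List Bool := onesFn ∘ nthF 1 ∘ fstF
/-- `1ᵏ`. [folklore] -/
noncomputable def KU : List Bool → List Bool := onesFn ∘ nthF 2 ∘ fstF
/-- `1^M`. [folklore] -/
noncomputable def MU : List Bool → List Bool := onesFn ∘ nthF 3 ∘ fstF
/-- `1ʲ`. [folklore] -/
noncomputable def jU : List Bool → List Bool := onesFn ∘ nthF 4 ∘ fstF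
/-- `[sgn]`. [folklore] -/
noncomputable def sgnB : List Bool → List Bool := headBitFn ∘ nthF 5 ∘ fstF
/-- `α`. [folklore] -/
def αF : List Bool → List Bool := nthF 6 ∘ fstF
/-- `ρ`. [folklore] -/
def ρF : List Bool → List Bool := sndPow 6 ∘ fstF
/-- `1^{kk}`. [folklore] -/
noncomputable def kkU : List Bool → List Bool := List.cons true ∘ logU ∘ MU
/-- The ruler `1^{2M}` (`≥ 2^kk`). [folklore] -/
noncomputable def rulerU : List Bool → List Bool := concatFn ∘ fanoutFn MU MU
/-- `1^{2^kk − 1}`. [folklore] -/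
noncomputable def twoKm1 : List Bool → List Bool := binToUnaryFn ∘ fanoutFn rulerU kkU
/-- `1^{kn}`. [folklore] -/
noncomputable def KnU : List Bool → List Bool := umulFn ∘ fanoutFn KU uN
/-- `1^{kk·n}`. [folklore] -/
noncomputable def knU : List Bool → List Bool := umulFn ∘ fanoutFn kkU uN
/-- `1^{jn}`. [folklore] -/
noncomputable def jnU : List Bool → List Bool := umulFn ∘ fanoutFn jU uN
/-- `1^{(j+1)n}`. [folklore] -/
noncomputable def j1nU : List Bool → List Bool := umulFn ∘ fanoutFn (List.cons true ∘ jU) uN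
/-- The side information `y = hdr a = ⟨a, ε⟩`. [folklore] -/
noncomputable def yF : List Bool → List Bool := fanoutFn aF fun _ => []

/-- `ω'` (`kn` bits). [folklore] -/
noncomputable def ωF : List Bool → List Bool := CondGen.fitF KnU (takeFn ∘ fanoutFn KnU sndF)
/-- `w ⇂ kn`. [folklore] -/
noncomputable def c1 : List Bool → List Bool := dropFn ∘ fanoutFn KnU sndF
/-- `u` (`k` bits). [folklore] -/
noncomputable def uF : List Bool → List Bool := CondGen.fitF KU (takeFn ∘ fanoutFn KU c1)
/-- The next cut. [folklore] -/
noncomputable def c2 : List Bool → List Bool := dropFn ∘ fanoutFn KU c1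
/-- The seeds (`kk·n` bits). [folklore] -/
noncomputable def SF : List Bool → List Bool := CondGen.fitF knU (takeFn ∘ fanoutFn knU c2)
/-- The next cut. [folklore] -/
noncomputable def c3 : List Bool → List Bool := dropFn ∘ fanoutFn knU c2
/-- `τ` (`kk` bits). [folklore] -/
noncomputable def τF : List Bool → List Bool := CondGen.fitF kkU (takeFn ∘ fanoutFn kkU c3)

/-- The parity bit `[u_j]`. [folklore] -/
noncomputable def parB : List Bool → List Bool := headBitFn ∘ dropFn ∘ fanoutFn jU uF
/-- The prefix `ω' ↾ jn`. [folklore] -/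
noncomputable def preF : List Bool → List Bool := takeFn ∘ fanoutFn jnU ωF
/-- The zero mask `0ⁿ` (so that the embedded query is the query). [folklore] -/
noncomputable def zF : List Bool → List Bool := Kannan.zerosFn ∘ uN
/-- The suffix `ω' ⇂ (j+1)n`. [folklore] -/
noncomputable def postF : List Bool → List Bool := dropFn ∘ fanoutFn j1nU ωF
/-- The bits `α ‖ u⇂j ‖ ρ`. [folklore] -/
noncomputable def vF : List Bool → List Bool :=
  concatFn ∘ fanoutFn (concatFn ∘ fanoutFn αF (dropFn ∘ fanoutFn jU uF)) ρF

/-- **The context record** `⟨1ⁿ, 1^kk, 1^{2^kk−1}, y, [sgn], [0], [0], [u_j], pre, 0ⁿ, 0ⁿ, post, v, ε, S, τ⟩`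
(the record of `GoldreichLevinProgram.lean`). [folklore] -/
noncomputable def ctxF : List Bool → List Bool :=
  fanoutFn uN (fanoutFn kkU (fanoutFn twoKm1 (fanoutFn yF (fanoutFn sgnB (fanoutFn (fun _ => [false]) (fanoutFn (fun _ => [false])
    (fanoutFn parB (fanoutFn preF (fanoutFn zF (fanoutFn zF (fanoutFn postF (fanoutFn vF
      (fanoutFn (fun _ => []) (fanoutFn SF τF))))))))))))))

/-- **The reconstruction as a string function on `z = ⟨params, w⟩`**: `n` coordinate rounds of the
Goldreich–Levin decoder of `GoldreichLevinProgram.lean` from `⟨1ⁿ, ⟨CTX, ⟨ε, ε⟩⟩⟩`, then the bits.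
[Hirahara 2021 (ECCC TR21-058), Lemma 3.14; Goldreich 2001, Thm. 2.5.6 (proof, §2.5.3); Arora–Barak 2009, Thm. 9.12]
[cite: Hirahara2021, Lemma 3.14] -/
noncomputable def hrecF : List Bool → List Bool :=
  sndPow 2 ∘ (fun z => (bitRound (DPRecon.testAlg D₀))^[(X : Polynomial ℕ).eval (boolUnpair z).1.length] z) ∘
    fanoutFn uN (fanoutFn ctxF (fanoutFn (fun _ => []) (fun _ => [])))

end Program

/-! ### Values on genuine parameters -/

section Values

variable (a : List Bool) (n k M j : ℕ) (sgn : Bool) (α ρ w : List Bool)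

/-- `⟨hparams …, w⟩`, the argument of the program. [folklore] -/
def zOf : List Bool := boolPair (hparams a n k M j sgn α ρ) w

/-- The coins. [folklore] -/
theorem sndF_zOf : sndF (zOf a n k M j sgn α ρ w) = w := by simp only [zOf, sndF_boolPair]
/-- Value of `aF`. [folklore] -/
theorem aF_apply : aF (zOf a n k M j sgn α ρ w) = a := by simp [aF, zOf, hparams, fstF]
/-- Value of `uN`. [folklore] -/
theorem uN_apply : uN (zOf a n k M j sgn α ρ w) = ones n := by
  simp [uN, zOf, hparams, onesFn_eq_ones, nthF, fstF, ones]
/-- Value of `KU`. [folklore] -/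
theorem KU_apply : KU (zOf a n k M j sgn α ρ w) = ones k := by
  simp [KU, zOf, hparams, onesFn_eq_ones, nthF, fstF, ones]
/-- Value of `MU`. [folklore] -/
theorem MU_apply : MU (zOf a n k M j sgn α ρ w) = ones M := by
  simp [MU, zOf, hparams, onesFn_eq_ones, nthF, fstF, ones]
/-- Value of `jU`. [folklore] -/
theorem jU_apply : jU (zOf a n k M j sgn α ρ w) = ones j := by
  simp [jU, zOf, hparams, onesFn_eq_ones, nthF, fstF, ones]
/-- Value of `sgnB`. [folklore] -/
theorem sgnB_apply : sgnB (zOf a n k M j sgn α ρ w) = [sgn] := by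
  simp [sgnB, zOf, hparams, nthF, fstF]
/-- Value of `αF`. [folklore] -/
theorem αF_apply : αF (zOf a n k M j sgn α ρ w) = α := by
  simp [αF, zOf, hparams, nthF, fstF]
/-- Value of `ρF`. [folklore] -/
theorem ρF_apply : ρF (zOf a n k M j sgn α ρ w) = ρ := by
  simp [ρF, zOf, hparams, sndPow, fstF]
/-- Value of `kkU`. [folklore] -/
theorem kkU_apply : kkU (zOf a n k M j sgn α ρ w) = ones (kkOf M) := by
  simp only [kkU, Function.comp_apply, MU_apply, logU_apply, List.length_replicate, true_cons_ones, kkOf]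
/-- Value of `rulerU`. [folklore] -/
theorem rulerU_apply : rulerU (zOf a n k M j sgn α ρ w) = ones (2 * M) := by
  simp only [rulerU, Function.comp_apply, fanoutFn_apply, MU_apply, concatFn_boolPair, Com.ones_append]; congr 1; ring
/-- Value of `twoKm1` (for `M ≥ 1`). [folklore] -/
theorem twoKm1_apply (hM : 1 ≤ M) : twoKm1 (zOf a n k M j sgn α ρ w) = ones (2 ^ kkOf M - 1) := by
  simp only [twoKm1, Function.comp_apply, fanoutFn_apply, rulerU_apply, kkU_apply, binToUnaryFn_boolPair, GLProg.bitsToNat_ones,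
    List.length_replicate]
  rw [min_eq_left]
  have := two_pow_kkOf_le hM
  omega
/-- Value of `KnU`. [folklore] -/
theorem KnU_apply : KnU (zOf a n k M j sgn α ρ w) = ones (k * n) := by
  simp only [KnU, Function.comp_apply, fanoutFn_apply, KU_apply, uN_apply, umulFn_boolPair]
/-- Value of `knU`. [folklore] -/
theorem knU_apply : knU (zOf a n k M j sgn α ρ w) = ones (kkOf M * n) := by
  simp only [knU, Function.comp_apply, fanoutFn_apply, kkU_apply, uN_apply, umulFn_boolPair]
/-- Value of `jnU`. [folklore] -/
theorem jnU_apply : jnU (zOf a n k M j sgn α ρ w) = ones (j * n) := by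
  simp only [jnU, Function.comp_apply, fanoutFn_apply, jU_apply, uN_apply, umulFn_boolPair]
/-- Value of `j1nU`. [folklore] -/
theorem j1nU_apply : j1nU (zOf a n k M j sgn α ρ w) = ones ((j + 1) * n) := by
  simp only [j1nU, Function.comp_apply, fanoutFn_apply, jU_apply, uN_apply, true_cons_ones, umulFn_boolPair]
/-- Value of `yF`. [folklore] -/
theorem yF_apply : yF (zOf a n k M j sgn α ρ w) = DPRecon.hdr a := by
  rw [show DPRecon.hdr a = boolPair a [] by simp [DPRecon.hdr, boolPair]]
  simp only [yF, fanoutFn_apply, aF_apply]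

/-- The segments of the coins. [folklore] -/
def mw1 : List Bool := w.drop (k * n)
/-- Segment. [folklore] -/
def mw2 : List Bool := (mw1 n k w).drop k
/-- Segment. [folklore] -/
def mw3 : List Bool := (mw2 n k w).drop (kkOf M * n)
/-- `ω'`. [folklore] -/
def mω : List Bool := CondParams.fitLen (w.take (k * n)) (k * n)
/-- `u`. [folklore] -/
def mu : List Bool := CondParams.fitLen ((mw1 n k w).take k) k
/-- The seeds. [folklore] -/
def mS : List Bool := CondParams.fitLen ((mw2 n k w).take (kkOf M * n)) (kkOf M * n)
/-- `τ`. [folklore] -/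
def mτ : List Bool := CondParams.fitLen ((mw3 n k M w).take (kkOf M)) (kkOf M)

/-- **The run through the named segments.** [folklore] -/
theorem hrun_eq (T : List Bool → Bool) :
    DPHybStr.hrun T n k (kkOf M) j sgn α w =
      candStr n (kkOf M) (DPHybStr.hybPred T n j sgn (mω n k w) (mu n k w) α) (mS n k M w) (mτ n k M w) := by
  simp only [DPHybStr.hrun, mω, mu, mw1, mS, mw2, mτ, mw3]

/-- Value of `ωF`. [folklore] -/
theorem ωF_apply : ωF (zOf a n k M j sgn α ρ w) = mω n k w := by
  simp only [ωF, Function.comp_apply, fanoutFn_apply, CondGen.fitF_apply, KnU_apply, sndF_zOf, takeFn_boolPair, List.length_replicate, mω]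
/-- Value of `c1`. [folklore] -/
theorem c1_apply : c1 (zOf a n k M j sgn α ρ w) = mw1 n k w := by
  simp only [c1, Function.comp_apply, fanoutFn_apply, KnU_apply, sndF_zOf, dropFn_boolPair, List.length_replicate, mw1]
/-- Value of `uF`. [folklore] -/
theorem uF_apply : uF (zOf a n k M j sgn α ρ w) = mu n k w := by
  simp only [uF, Function.comp_apply, fanoutFn_apply, CondGen.fitF_apply, KU_apply, c1_apply, takeFn_boolPair, List.length_replicate, mu]
/-- Value of `c2`. [folklore] -/
theorem c2_apply : c2 (zOf a n k M j sgn α ρ w) = mw2 n k w := by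
  simp only [c2, Function.comp_apply, fanoutFn_apply, KU_apply, c1_apply, dropFn_boolPair, List.length_replicate, mw2]
/-- Value of `SF`. [folklore] -/
theorem SF_apply : SF (zOf a n k M j sgn α ρ w) = mS n k M w := by
  simp only [SF, Function.comp_apply, fanoutFn_apply, CondGen.fitF_apply, knU_apply, c2_apply, takeFn_boolPair, List.length_replicate, mS]
/-- Value of `c3`. [folklore] -/
theorem c3_apply : c3 (zOf a n k M j sgn α ρ w) = mw3 n k M w := by
  simp only [c3, Function.comp_apply, fanoutFn_apply, knU_apply, c2_apply, dropFn_boolPair, List.length_replicate, mw3]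
/-- Value of `τF`. [folklore] -/
theorem τF_apply : τF (zOf a n k M j sgn α ρ w) = mτ n k M w := by
  simp only [τF, Function.comp_apply, fanoutFn_apply, CondGen.fitF_apply, kkU_apply, c3_apply, takeFn_boolPair, List.length_replicate, mτ]

/-- Value of `parB`. [folklore] -/
theorem parB_apply : parB (zOf a n k M j sgn α ρ w) = [(mu n k w).getD j false] := by
  simp only [parB, Function.comp_apply, fanoutFn_apply, jU_apply, uF_apply, dropFn_boolPair, List.length_replicate, headBitFn_apply,
    AffineProg.headD_drop]
/-- Value of `preF`. [folklore] -/
theorem preF_apply : preF (zOf a n k M j sgn α ρ w) = (mω n k w).take (j * n) := by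
  simp only [preF, Function.comp_apply, fanoutFn_apply, jnU_apply, ωF_apply, takeFn_boolPair, List.length_replicate]
/-- Value of `zF`. [folklore] -/
theorem zF_apply : zF (zOf a n k M j sgn α ρ w) = List.replicate n false := by
  simp only [zF, Function.comp_apply, uN_apply, Kannan.zerosFn_apply, List.length_replicate]
/-- Value of `postF`. [folklore] -/
theorem postF_apply : postF (zOf a n k M j sgn α ρ w) = (mω n k w).drop ((j + 1) * n) := by
  simp only [postF, Function.comp_apply, fanoutFn_apply, j1nU_apply, ωF_apply, dropFn_boolPair, List.length_replicate]
/-- Value of `vF`. [folklore] -/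
theorem vF_apply : vF (zOf a n k M j sgn α ρ w) = (α ++ (mu n k w).drop j) ++ ρ := by
  simp only [vF, Function.comp_apply, fanoutFn_apply, αF_apply, jU_apply, uF_apply, ρF_apply, dropFn_boolPair, List.length_replicate,
    concatFn_boolPair]

/-- **The context record on genuine parameters** (`M ≥ 1`). [folklore] -/
theorem ctxF_apply (hM : 1 ≤ M) : ctxF (zOf a n k M j sgn α ρ w) =
    GLProg.ctxRec n (kkOf M) (2 ^ kkOf M - 1) (DPRecon.hdr a) sgn false false ((mu n k w).getD j false)
      ((mω n k w).take (j * n)) (List.replicate n false) (List.replicate n false) ((mω n k w).drop ((j + 1) * n))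
      ((α ++ (mu n k w).drop j) ++ ρ) [] (mS n k M w) (mτ n k M w) := by
  simp only [ctxF, fanoutFn_apply, uN_apply, kkU_apply, twoKm1_apply a n k M j sgn α ρ w hM, yF_apply, sgnB_apply, parB_apply,
    preF_apply, zF_apply, postF_apply, vF_apply, SF_apply, τF_apply, GLProg.ctxRec]

/-! ### The record-level predictor is the string predictor -/

/-- Xoring with zeros truncates. [folklore] -/
theorem vxor_replicate_false : ∀ (r : List Bool) (n : ℕ), vxor r (List.replicate n false) = r.take n
  | [], n => by simp [vxor]
  | b :: r, 0 => by simp [vxor]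
  | b :: r, n + 1 => by
    rw [List.replicate_succ, vxor, List.zipWith_cons_cons, Bool.xor_false, List.take_succ_cons, ← vxor, vxor_replicate_false r n]

/-- **The record-level predictor of `GoldreichLevinProgram.lean`, fed with this file's context, is
`DPHybStr.hybPred`** for the test `ω ↦ [⟨a, ω ‖ ρ⟩ ∈ D₀]`. [cite: Hirahara2021, Lemma 3.14 (proof)] -/
theorem predRec_hyb (D₀ : Set (List Bool)) (ω' u : List Bool) :
    GLProg.predRec (DPRecon.testAlg D₀) n (DPRecon.hdr a) sgn false false (u.getD j false) (ω'.take (j * n))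
        (List.replicate n false) (List.replicate n false) (ω'.drop ((j + 1) * n)) ((α ++ u.drop j) ++ ρ) [] =
      DPHybStr.hybPred (fun ω => D₀.boolIndicator (boolPair a (ω ++ ρ))) n j sgn ω' u α := by
  funext r
  unfold GLProg.predRec DPHybStr.hybPred
  rw [if_neg Bool.false_ne_true, vxor_replicate_false, vxor_replicate_false, List.take_take, min_self]
  simp only [DPRecon.testAlg, boolUnpair_boolPair, List.append_assoc]
  rw [DPRecon.hdr_append]

/-- **`hrecF ⟨hparams a n k M j sgn α ρ, w⟩ = hrun … w`** (`M ≥ 1`). [cite: Hirahara2021, Lemma 3.14] -/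
theorem hrecF_apply (D₀ : Set (List Bool)) (hM : 1 ≤ M) :
    hrecF D₀ (zOf a n k M j sgn α ρ w) =
      DPHybStr.hrun (fun ω => D₀.boolIndicator (boolPair a (ω ++ ρ))) n k (kkOf M) j sgn α w := by
  have hinit : fanoutFn uN (fanoutFn ctxF (fanoutFn (fun _ => []) (fun _ => []))) (zOf a n k M j sgn α ρ w) =
      boolPair (ones n) (boolPair (ctxF (zOf a n k M j sgn α ρ w)) (boolPair (ones 0) [])) := by
    simp only [fanoutFn_apply, uN_apply]; rfl
  rw [hrun_eq, hrecF, Function.comp_apply, Function.comp_apply, hinit, boolUnpair_boolPair, List.length_replicate, eval_X,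
    ctxF_apply a n k M j sgn α ρ w hM, GLProg.iterate_bitRound, zero_add, List.nil_append, sndPow_succ_boolPair, sndPow_succ_boolPair,
    sndPow_zero_boolPair, candStr, List.ofFn_eq_map]
  rw [show List.range' 0 n = List.range n from List.range_eq_range'.symm, ← List.map_coe_finRange_eq_range, List.map_map]
  refine List.map_congr_left fun i _ => ?_
  simp only [Function.comp_apply, GLProg.bitRec, GLProg.cntRec, candBit, voteCount, vote, GLProg.voteRec, predRec_hyb]
  rw [decide_eq_decide]
  have := Nat.one_le_two_pow (n := kkOf M)
  omega

end Values

/-! ### Polynomial time -/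

section FPProofs

variable (D₀ : Set (List Bool))

/-- The parameter functions are in `FP`. [folklore] -/
theorem params_mem_FP : aF ∈ FP ∧ uN ∈ FP ∧ KU ∈ FP ∧ MU ∈ FP ∧ jU ∈ FP ∧ sgnB ∈ FP ∧ αF ∈ FP ∧ ρF ∈ FP ∧ kkU ∈ FP ∧
    twoKm1 ∈ FP ∧ KnU ∈ FP ∧ knU ∈ FP ∧ jnU ∈ FP ∧ j1nU ∈ FP := by
  have ha : aF ∈ FP := comp_mem_FP fstF_mem_FP fstF_mem_FP
  have huN : uN ∈ FP := comp_mem_FP onesFn_mem_FP (comp_mem_FP (nthF_mem_FP 1) fstF_mem_FP)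
  have hK : KU ∈ FP := comp_mem_FP onesFn_mem_FP (comp_mem_FP (nthF_mem_FP 2) fstF_mem_FP)
  have hM : MU ∈ FP := comp_mem_FP onesFn_mem_FP (comp_mem_FP (nthF_mem_FP 3) fstF_mem_FP)
  have hj : jU ∈ FP := comp_mem_FP onesFn_mem_FP (comp_mem_FP (nthF_mem_FP 4) fstF_mem_FP)
  have hsgn : sgnB ∈ FP := comp_mem_FP headBitFn_mem_FP (comp_mem_FP (nthF_mem_FP 5) fstF_mem_FP)
  have hα : αF ∈ FP := comp_mem_FP (nthF_mem_FP 6) fstF_mem_FP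
  have hρ : ρF ∈ FP := comp_mem_FP (sndPow_mem_FP 6) fstF_mem_FP
  have hkk : kkU ∈ FP := comp_mem_FP (cons_mem_FP true) (comp_mem_FP logU_mem_FP hM)
  have hruler : rulerU ∈ FP := comp_mem_FP concatFn_mem_FP (fanoutFn_mem_FP hM hM)
  have htwo : twoKm1 ∈ FP := comp_mem_FP binToUnaryFn_mem_FP (fanoutFn_mem_FP hruler hkk)
  have hKn : KnU ∈ FP := comp_mem_FP umulFn_mem_FP (fanoutFn_mem_FP hK huN)
  have hkn : knU ∈ FP := comp_mem_FP umulFn_mem_FP (fanoutFn_mem_FP hkk huN)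
  have hjn : jnU ∈ FP := comp_mem_FP umulFn_mem_FP (fanoutFn_mem_FP hj huN)
  have hj1n : j1nU ∈ FP := comp_mem_FP umulFn_mem_FP (fanoutFn_mem_FP (comp_mem_FP (cons_mem_FP true) hj) huN)
  exact ⟨ha, huN, hK, hM, hj, hsgn, hα, hρ, hkk, htwo, hKn, hkn, hjn, hj1n⟩

/-- **`hrecF D₀ ∈ FP`** for `D₀ ∈ P`. [cite: Hirahara2021, Lemma 3.14] -/
theorem hrecF_mem_FP (hD : D₀ ∈ Classes.P) : hrecF D₀ ∈ FP := by
  obtain ⟨ha, huN, hK, -, hj, hsgn, hα, hρ, hkk, htwo, hKn, hkn, hjn, hj1n⟩ := params_mem_FP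
  have hy : yF ∈ FP := fanoutFn_mem_FP ha (const_mem_FP _)
  have hω : ωF ∈ FP := CondGen.fitF_mem_FP hKn (comp_mem_FP takeFn_mem_FP (fanoutFn_mem_FP hKn sndF_mem_FP))
  have h1 : c1 ∈ FP := comp_mem_FP dropFn_mem_FP (fanoutFn_mem_FP hKn sndF_mem_FP)
  have hu : uF ∈ FP := CondGen.fitF_mem_FP hK (comp_mem_FP takeFn_mem_FP (fanoutFn_mem_FP hK h1))
  have h2 : c2 ∈ FP := comp_mem_FP dropFn_mem_FP (fanoutFn_mem_FP hK h1)
  have hS : SF ∈ FP := CondGen.fitF_mem_FP hkn (comp_mem_FP takeFn_mem_FP (fanoutFn_mem_FP hkn h2))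
  have h3 : c3 ∈ FP := comp_mem_FP dropFn_mem_FP (fanoutFn_mem_FP hkn h2)
  have hτ : τF ∈ FP := CondGen.fitF_mem_FP hkk (comp_mem_FP takeFn_mem_FP (fanoutFn_mem_FP hkk h3))
  have hpar : parB ∈ FP := comp_mem_FP headBitFn_mem_FP (comp_mem_FP dropFn_mem_FP (fanoutFn_mem_FP hj hu))
  have hpre : preF ∈ FP := comp_mem_FP takeFn_mem_FP (fanoutFn_mem_FP hjn hω)
  have hz : zF ∈ FP := comp_mem_FP Kannan.zerosFn_mem_FP huN
  have hpost : postF ∈ FP := comp_mem_FP dropFn_mem_FP (fanoutFn_mem_FP hj1n hω)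
  have hv : vF ∈ FP := comp_mem_FP concatFn_mem_FP (fanoutFn_mem_FP (comp_mem_FP concatFn_mem_FP (fanoutFn_mem_FP hα
    (comp_mem_FP dropFn_mem_FP (fanoutFn_mem_FP hj hu)))) hρ)
  have hctx : ctxF ∈ FP :=
    fanoutFn_mem_FP huN (fanoutFn_mem_FP hkk (fanoutFn_mem_FP htwo (fanoutFn_mem_FP hy (fanoutFn_mem_FP hsgn (fanoutFn_mem_FP (const_mem_FP _)
      (fanoutFn_mem_FP (const_mem_FP _) (fanoutFn_mem_FP hpar (fanoutFn_mem_FP hpre (fanoutFn_mem_FP hz (fanoutFn_mem_FP hz (fanoutFn_mem_FP hpost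
        (fanoutFn_mem_FP hv (fanoutFn_mem_FP (const_mem_FP _) (fanoutFn_mem_FP hS hτ))))))))))))))
  exact comp_mem_FP (sndPow_mem_FP 2) (comp_mem_FP (iterate_mem_FP (GLProg.bitRound_mem_FP (DPRecon.dStr_testAlg_mem_FP D₀ hD)) 9
    GLProg.length_bitRound_le X) (fanoutFn_mem_FP huN (fanoutFn_mem_FP hctx (fanoutFn_mem_FP (const_mem_FP _) (const_mem_FP _)))))

end FPProofs

end DPHybProg

end Literature.Computability.MetaComplexity

end
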